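import Summits.QuantumFields.BalabanUV.T4Continuum.Support.VariationalVectorEndFlatMin
import Summits.QuantumFields.BalabanUV.T4Continuum.Support.VariationalMonotoneTower
import Literature.MathematicalPhysics.QuantumFieldTheory.Balaban1983to89.B5Hk163RDiv
import Summits.QuantumFields.BalabanUV.T4Continuum.Support.RegionGaugeSlice

/-!
# T⁴ programme, spine node NE2 (U1a), lane P2 — THE `U = 1` VECTOR END IN [B5]'s LETTERS: road P2's flat effective action IS Bałaban's minimal curvature energy of `H_k`
# ([B5] (1.63), p.29), hence the normalised energies `n_k^{−d}·⟨H_{n_k}B, (Δ−∂∂*)H_{n_k}B⟩` converge along `n_k = L^k` (model level = the free field; cell `pub-balaban`)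

NE2 formalisation swarm `b2b-balaban-t4-ne2-formalise-*`, leaf prover 10 GEN 3 (`prover-b2b-balaban-t4-ne2-formalise-leaf-10-g3-0`, V-END holder lineage); journal INTENT
CLAIMS.log 2026-08-20 17:38Z l.18485.  A DICTIONARY at `U = 1` between the road's typed objects and the kernel-REPRODUCED [B5] objects, then the road's closed END read through it.
Engine: leaf-09-g7's B5-faithfulness file `VariationalVectorGaugeSliceB5` (p222476: `QvOp_unc` — B5's block average (1.18) IS the road's flat line average; `form_DeltaA_unc` —
`⟨A, Δ_a A⟩ = n^d·(ScV 1 (projG 1 (ker Q′_1)) W + a‖Q W‖²)`; `form_gauge_unc`), and the pv15∕b05 lineage's `B5Hk163RDiv` (`HkOp_minimum` — [B5] p.29 «`H_kB` is a minimum of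
`½⟨∂A,∂A⟩` on the hyperplane `{Q_kA = B, R∂*A = 0}`», `R_divS_HkOp`) ∕ `B5Hk163Torus.QvOp_HkOp_mulVec`.
 * §1 `DeltaA_zero_eq`: `Δ₀ = (Δ − ∂∂ᴴ) + ∂(1 − P)∂ᴴ` (definitional algebra on [B5] (1.69) ∕ (1.21)); `form_gauge_re`, `form_DeltaA_zero_re`, `form_DeltaA_zero_split`, `gauge_HkOp` (the gauge summand's
   form is `n²·projG ≥ 0` and the summand VANISHES at `H_kB`).
 * §2 **`blockSpin_flat_eq_HkOp`** (+ **`flat_minimiser_eq_HkOp`**: the road's flat fibre-minimiser IS `H_kB` — [B5] p.29's uniqueness): `blockSpin (QvL n M 1) (ScV n M 1 (projG 1 (ker Q′_1))) φ = n^{−d}·Re⟨H_k(unc φ), (Δ−∂∂ᴴ) H_k(unc φ)⟩` — the road's flat block-spin VALUE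
   (decision (D1): the full fibre) IS the curvature energy of Bałaban's minimiser `H_kB`, `B = unc φ`.
 * §3 **`effV_flat_form_eq_HkOp`**: the road's Hermitian effective operator `effV n M 1 (GmFlat n M) (QmL n M 1) a` has the form `φ ↦ n^{−d}·Re⟨H_kB, (Δ−∂∂ᴴ)H_kB⟩` (the
   auxiliary `a > 0` drops out).
 * §4 **`HkOp_energy_tendsto`**: for `1 ≤ d`, `2 ≤ L`: `∃ X∞, ∀ B, n_k^{−d}·Re⟨H_{n_k}B, (Δ−∂∂ᴴ)H_{n_k}B⟩ → Re⟨B, X∞ B⟩` along `n_k = L^k` — the road's closed U = 1 END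
   (`VariationalVectorEndFlatMin.effV_flat_limit`, p226153) read on [B5]'s `H_k`; **`HkOp_energy_rate`**: the same with the explicit rate `C⋆·(L⁻²)^k∕(1−L⁻²)·nsq B`
   (via `|qform X v| ≤ ‖X‖·nsq v`, leaf-07's `RegionGaugeSlice.re_form_le_opNorm`).

HONEST FRAMING (T4-DAG p. 1).  `U = 1` only (the free field); the [B5] side consists of the cell's kernel-REPRODUCED objects (`HkOp` = (1.63) as typed in `B5Hk163Torus`, `DstarD`
= `Δ − ∂∂*` with the form identity (1.21), `DeltaA` = (1.69)) — Literature modules with citation headers, nothing printed used as a hypothesis; at `U = 1` the dictionary road ⟷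
[B5] is a THEOREM (c5 concerns the background dictionary, which is NOT asserted); [folklore] composition; no `def`, no `sorry`; axioms standard.  V-END with background ∕ NE2 NOT
proved; NE3 OPEN; spine PROVED 0∕9 unchanged; rung (B)+1 on a fixed finite T⁴ — NOT infinite volume, NOT mass gap, NOT Clay.  HONEST DEPENDENCY (cell, verbatim): continuum YM on
T⁴ ⇐ BetaPertH ∧ nine spine estimates (0/9 proved); BetaPertH ⇐ (D1) ∧ (D4) ∧ CAP+tail; G-an2-4 gates asym, D1 and NE2/3/4.
-/

noncomputable section

namespace Summit.QuantumFields.BalabanUV.T4Continuum.VariationalVectorEndFlatB5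

open Filter Matrix
open scoped Matrix ComplexConjugate ComplexOrder Topology Matrix.Norms.L2Operator
open Literature.MathematicalPhysics.QuantumFieldTheory.Balaban1983to89
open Literature.MathematicalPhysics.QuantumFieldTheory.Balaban1983to89.B5Prop11Plancherel (Tor fine)
open Literature.MathematicalPhysics.QuantumFieldTheory.Balaban1983to89.B5Block118 (QvOp)
open Literature.MathematicalPhysics.QuantumFieldTheory.Balaban1983to89.B5Action121 (GradOp)
open Literature.MathematicalPhysics.QuantumFieldTheory.Balaban1983to89.B5Value126 (PcT)
open Literature.MathematicalPhysics.QuantumFieldTheory.Balaban1983to89.B5DeltaA169 (DeltaA)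
open Literature.MathematicalPhysics.QuantumFieldTheory.Balaban1983to89.B5Hk163Torus (HkOp QvOp_HkOp_mulVec)
open Literature.MathematicalPhysics.QuantumFieldTheory.Balaban1983to89.B5Hk163RDiv (DstarD HkOp_minimum HkOp_minimum_unique R_divS_HkOp)
open Literature.Analysis.Complex (qform qform_sub)
open Literature.MathematicalPhysics.QuantumFieldTheory.Balaban1983to89.B5Prop11Lower (nsq nsq_nonneg)
open Summit.QuantumFields.BalabanUV.T4Continuum.RegionGaugeSlice (re_form_le_opNorm)
open Summit.QuantumFields.BalabanUV.T4Continuum.VariationalTransfer (blockSpin blockSpin_le le_blockSpin)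
open Summit.QuantumFields.BalabanUV.T4Continuum.VectorBlockTrialForm (nsqV QvL)
open Summit.QuantumFields.BalabanUV.T4Continuum.VariationalVectorForm (ScV ScV_nonneg)
open Summit.QuantumFields.BalabanUV.T4Continuum.VariationalVectorEffective (unc cur unc_cur cur_unc effV blockSpin_ScV_eq)
open Summit.QuantumFields.BalabanUV.T4Continuum.VariationalVectorTower (QmL avg_QmL avg_QmL_eq QmL_mulVec_surjective)
open Summit.QuantumFields.BalabanUV.T4Continuum.VariationalVectorGaugeSlice (projG projG_nonneg)
open Summit.QuantumFields.BalabanUV.T4Continuum.VariationalVectorGaugeSliceFlat (kerAvgFlat)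
open Summit.QuantumFields.BalabanUV.T4Continuum.VariationalVectorGaugeSliceB5 (flatR QvOp_unc form_DeltaA_unc form_gauge_unc hPc_flat)
open Summit.QuantumFields.BalabanUV.T4Continuum.VariationalVectorGaugeSliceTower (GmFlat GmFlat_posSemidef projG_flat_eq_qform Gmk)
open Summit.QuantumFields.BalabanUV.T4Continuum.VariationalVectorForm (lamV)
open Summit.QuantumFields.BalabanUV.T4Continuum.CTGaugeTerm (BXp)
open Summit.QuantumFields.BalabanUV.T4Continuum.ScalarAveragedCompression (sigma0)
open Literature.MathematicalPhysics.QuantumFieldTheory.Balaban1983to89.B5Prop11Plancherel (Cst)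
open Summit.QuantumFields.BalabanUV.T4Continuum.VariationalVectorGaugeSliceUB (QvL_flat_surjective)
open Summit.QuantumFields.BalabanUV.T4Continuum.VariationalVectorEndFlatMin (effV_flat_limit)
open Summit.QuantumFields.BalabanUV.T4Continuum.VariationalMonotoneTower (continuous_qform_left)

variable {d : ℕ} (n : ℕ) [NeZero n] (M : Fin d → ℕ) [hM : ∀ μ, NeZero (M μ)]

/-! ## §1 `Δ₀ = (Δ − ∂∂ᴴ) + ∂(1 − P)∂ᴴ` and the gauge summand -/

/-- [B5]'s `Δ_a` at `a = 0` splits as the curvature operator `Δ − ∂∂ᴴ` of (1.21) plus the gauge summand `∂(1 − P)∂ᴴ` (definitional algebra). [folklore] -/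
theorem DeltaA_zero_eq :
    DeltaA n M 0 = DstarD n M + GradOp (fine n M) (n : ℂ) * (1 - PcT n M (n : ℂ)) * (GradOp (fine n M) (n : ℂ))ᴴ := by
  unfold DeltaA DstarD
  rw [Complex.ofReal_zero, zero_smul, add_zero, Matrix.mul_sub, Matrix.sub_mul, Matrix.mul_one]
  abel

/-- the gauge summand's form on an uncurried road field: `⟨unc W, ∂(1−P)∂ᴴ unc W⟩ = n²·projG 1 (ker Q′_1) W` — real and nonnegative. [folklore] -/
theorem form_gauge_re (W : Tor (fine n M) → Fin d → ℂ) :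
    (star (unc W) ⬝ᵥ ((GradOp (fine n M) (n : ℂ) * (1 - PcT n M (n : ℂ)) * (GradOp (fine n M) (n : ℂ))ᴴ) *ᵥ unc W)).re
      = (n : ℝ) ^ 2 * projG (fine n M) (flatR n M) (kerAvgFlat n M) W := by
  rw [form_gauge_unc, Complex.ofReal_re]

/-- the curvature form in the road's letters: `Re⟨unc W, Δ₀ unc W⟩ = n^d·ScV n M 1 (projG …) W`. [folklore] -/
theorem form_DeltaA_zero_re (W : Tor (fine n M) → Fin d → ℂ) :
    (star (unc W) ⬝ᵥ (DeltaA n M 0 *ᵥ unc W)).re = (n : ℝ) ^ d * ScV n M (flatR n M) (projG (fine n M) (flatR n M) (kerAvgFlat n M)) W := by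
  rw [form_DeltaA_unc, Complex.ofReal_re, zero_mul, add_zero]

/-- the split of the forms: `Re⟨A, Δ₀ A⟩ = Re⟨A, (Δ−∂∂ᴴ)A⟩ + Re⟨A, ∂(1−P)∂ᴴ A⟩`. [folklore] -/
theorem form_DeltaA_zero_split (A : Tor (fine n M) × Fin d → ℂ) :
    (star A ⬝ᵥ (DeltaA n M 0 *ᵥ A)).re
      = (star A ⬝ᵥ (DstarD n M *ᵥ A)).re + (star A ⬝ᵥ ((GradOp (fine n M) (n : ℂ) * (1 - PcT n M (n : ℂ)) * (GradOp (fine n M) (n : ℂ))ᴴ) *ᵥ A)).re := by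
  rw [DeltaA_zero_eq, Matrix.add_mulVec, dotProduct_add, Complex.add_re]

/-- the gauge summand VANISHES at Bałaban's minimiser: `∂(1−P)∂ᴴ (H_kB) = 0` ([B5] p.29: `R∂*H_kB = 0`). [folklore] -/
theorem gauge_HkOp (B : Tor M × Fin d → ℂ) :
    (GradOp (fine n M) (n : ℂ) * (1 - PcT n M (n : ℂ)) * (GradOp (fine n M) (n : ℂ))ᴴ) *ᵥ (HkOp n M *ᵥ B) = 0 := by
  rw [← Matrix.mulVec_mulVec, ← Matrix.mulVec_mulVec, R_divS_HkOp, Matrix.mulVec_zero]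

/-! ## §2 The road's flat block-spin value IS the curvature energy of `H_kB` -/

/-- **DICTIONARY**: for every unit-lattice 1-form datum `φ`, the road's flat block-spin value over the full fibre of the gauge-projected curl form equals the normalised
curvature energy of Bałaban's minimiser: `blockSpin (QvL n M 1) (ScV n M 1 (projG 1 (ker Q′_1))) φ = n^{−d}·Re⟨H_k(unc φ), (Δ−∂∂ᴴ) H_k(unc φ)⟩`.  (≤): `H_kB` lies in the fibre
and its gauge summand vanishes; (≥): [B5] p.29's minimum property of `H_kB` for `½⟨∂A,∂A⟩` plus nonnegativity of the gauge summand. [folklore] -/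
theorem blockSpin_flat_eq_HkOp (φ : Tor M → Fin d → ℂ) :
    blockSpin (QvL n M (fun _ _ _ _ => (1 : ℂ →L[ℂ] ℂ))) (ScV n M (flatR n M) (projG (fine n M) (flatR n M) (kerAvgFlat n M))) φ
      = ((n : ℝ) ^ d)⁻¹ * (star (HkOp n M *ᵥ unc φ) ⬝ᵥ (DstarD n M *ᵥ (HkOp n M *ᵥ unc φ))).re := by
  have hn : (0 : ℝ) < (n : ℝ) ^ d := by have := Nat.pos_of_ne_zero (NeZero.ne n); positivity
  have hG0 : ∀ W, 0 ≤ projG (fine n M) (flatR n M) (kerAvgFlat n M) W := fun W => projG_nonneg _ _ _ W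
  set B : Tor M × Fin d → ℂ := unc φ with hB
  -- `H_kB`, curried, lies in the fibre of `φ`
  have hfib : QvL n M (fun _ _ _ _ => (1 : ℂ →L[ℂ] ℂ)) (cur (HkOp n M *ᵥ B)) = φ := by
    have h1 : QvOp n M *ᵥ unc (cur (HkOp n M *ᵥ B)) = unc φ := by rw [unc_cur, QvOp_HkOp_mulVec]
    rw [QvOp_unc] at h1
    have h2 := congrArg cur h1
    rwa [cur_unc, cur_unc] at h2
  -- its value: the gauge summand vanishes
  have hval : ScV n M (flatR n M) (projG (fine n M) (flatR n M) (kerAvgFlat n M)) (cur (HkOp n M *ᵥ B))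
      = ((n : ℝ) ^ d)⁻¹ * (star (HkOp n M *ᵥ B) ⬝ᵥ (DstarD n M *ᵥ (HkOp n M *ᵥ B))).re := by
    have h := form_DeltaA_zero_re n M (cur (HkOp n M *ᵥ B))
    rw [unc_cur, form_DeltaA_zero_split, gauge_HkOp, dotProduct_zero, Complex.zero_re, add_zero] at h
    rw [h, inv_mul_cancel_left₀ hn.ne']
  apply le_antisymm
  · -- (≤): the minimiser is a competitor
    rw [← hval]
    exact blockSpin_le (ScV_nonneg n M (flatR n M) hG0) hfib
  · -- (≥): every competitor has at least the curvature energy of `H_kB`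
    refine le_blockSpin ⟨cur (HkOp n M *ᵥ B), hfib⟩ fun W hW => ?_
    have hA : QvOp n M *ᵥ unc W = B := by rw [QvOp_unc, hW]
    have hmin := HkOp_minimum n M B (unc W) hA
    have hsplit := form_DeltaA_zero_split n M (unc W)
    have hgauge : 0 ≤ (star (unc W) ⬝ᵥ ((GradOp (fine n M) (n : ℂ) * (1 - PcT n M (n : ℂ)) * (GradOp (fine n M) (n : ℂ))ᴴ) *ᵥ unc W)).re := by
      rw [form_gauge_re]; exact mul_nonneg (by positivity) (hG0 W)
    have hform := form_DeltaA_zero_re n M W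
    -- `n^{-d}·Re⟨H_kB, (Δ−∂∂ᴴ)H_kB⟩ ≤ n^{-d}·Re⟨unc W, Δ₀ unc W⟩ = ScV W`
    have h1 : (star (HkOp n M *ᵥ B) ⬝ᵥ (DstarD n M *ᵥ (HkOp n M *ᵥ B))).re ≤ (n : ℝ) ^ d * ScV n M (flatR n M) (projG (fine n M) (flatR n M) (kerAvgFlat n M)) W := by
      rw [← hform, hsplit]; linarith
    calc ((n : ℝ) ^ d)⁻¹ * (star (HkOp n M *ᵥ B) ⬝ᵥ (DstarD n M *ᵥ (HkOp n M *ᵥ B))).re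
        ≤ ((n : ℝ) ^ d)⁻¹ * ((n : ℝ) ^ d * ScV n M (flatR n M) (projG (fine n M) (flatR n M) (kerAvgFlat n M)) W) :=
          mul_le_mul_of_nonneg_left h1 (inv_nonneg.mpr hn.le)
      _ = ScV n M (flatR n M) (projG (fine n M) (flatR n M) (kerAvgFlat n M)) W := inv_mul_cancel_left₀ hn.ne' _

/-- **THE ROAD's FLAT FIBRE-MINIMISER IS BAŁABAN's `H_kB`**: if `W` minimises `ScV n M 1 (projG 1 (ker Q′_1))` on the fibre `{QvL n M 1 · = φ}`, then `unc W = H_k (unc φ)`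
([B5] p.29's uniqueness, `HkOp_minimum_unique`: the gauge summand of a minimiser must vanish, which is exactly `R∂*A = 0`). [folklore] -/
theorem flat_minimiser_eq_HkOp (φ : Tor M → Fin d → ℂ) (W : Tor (fine n M) → Fin d → ℂ)
    (hW : QvL n M (fun _ _ _ _ => (1 : ℂ →L[ℂ] ℂ)) W = φ)
    (hmin : ∀ W₂, QvL n M (fun _ _ _ _ => (1 : ℂ →L[ℂ] ℂ)) W₂ = φ →
      ScV n M (flatR n M) (projG (fine n M) (flatR n M) (kerAvgFlat n M)) W ≤ ScV n M (flatR n M) (projG (fine n M) (flatR n M) (kerAvgFlat n M)) W₂) :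
    unc W = HkOp n M *ᵥ unc φ := by
  have hn0 : (n : ℂ) ≠ 0 := by exact_mod_cast NeZero.ne n
  have hn : (0 : ℝ) < (n : ℝ) ^ d := by have := Nat.pos_of_ne_zero (NeZero.ne n); positivity
  have hn2 : (0 : ℝ) < (n : ℝ) ^ 2 := by have := Nat.pos_of_ne_zero (NeZero.ne n); positivity
  have hG0 : ∀ W, 0 ≤ projG (fine n M) (flatR n M) (kerAvgFlat n M) W := fun W => projG_nonneg _ _ _ W
  set B : Tor M × Fin d → ℂ := unc φ with hB
  have hA : QvOp n M *ᵥ unc W = B := by rw [QvOp_unc, hW]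
  -- the minimum value is the curvature energy of `H_kB`
  have hval : ScV n M (flatR n M) (projG (fine n M) (flatR n M) (kerAvgFlat n M)) W
      = ((n : ℝ) ^ d)⁻¹ * (star (HkOp n M *ᵥ B) ⬝ᵥ (DstarD n M *ᵥ (HkOp n M *ᵥ B))).re := by
    rw [← blockSpin_flat_eq_HkOp]
    exact (VariationalTransfer.blockSpin_eq_of_isMin (ScV_nonneg n M (flatR n M) hG0) hW hmin).symm
  -- hence the gauge summand of `W` vanishes and its curvature energy is minimal
  have hsplit := form_DeltaA_zero_split n M (unc W)
  have hform := form_DeltaA_zero_re n M W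
  have hcurl := HkOp_minimum n M B (unc W) hA
  have hgauge0 : 0 ≤ (star (unc W) ⬝ᵥ ((GradOp (fine n M) (n : ℂ) * (1 - PcT n M (n : ℂ)) * (GradOp (fine n M) (n : ℂ))ᴴ) *ᵥ unc W)).re := by
    rw [form_gauge_re]; exact mul_nonneg hn2.le (hG0 W)
  have hE : (star (unc W) ⬝ᵥ (DeltaA n M 0 *ᵥ unc W)).re = (star (HkOp n M *ᵥ B) ⬝ᵥ (DstarD n M *ᵥ (HkOp n M *ᵥ B))).re := by
    rw [hform, hval, mul_inv_cancel_left₀ hn.ne']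
  have hgauge : (star (unc W) ⬝ᵥ ((GradOp (fine n M) (n : ℂ) * (1 - PcT n M (n : ℂ)) * (GradOp (fine n M) (n : ℂ))ᴴ) *ᵥ unc W)).re = 0 := by
    linarith
  have hcurl' : (star (unc W) ⬝ᵥ (DstarD n M *ᵥ unc W)).re ≤ (star (HkOp n M *ᵥ B) ⬝ᵥ (DstarD n M *ᵥ (HkOp n M *ᵥ B))).re := by linarith
  -- vanishing gauge summand ⟹ `R∂*(unc W) = 0`
  have hproj : projG (fine n M) (flatR n M) (kerAvgFlat n M) W = 0 := by
    rw [form_gauge_re] at hgauge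
    rcases mul_eq_zero.mp hgauge with h | h
    · exact absurd h hn2.ne'
    · exact h
  have hdiv : (1 - PcT n M (n : ℂ)) *ᵥ VariationalVectorWeitzenbock.divV (fine n M) (flatR n M) W = 0 := by
    apply VariationalEffectiveOperator.eq_zero_of_nsq_le_zero
    rw [← VariationalVectorGaugeSliceB5.projG_flat_eq_nsq, hproj]
  have hR : (1 - PcT n M (n : ℂ)) *ᵥ ((GradOp (fine n M) (n : ℂ))ᴴ *ᵥ unc W) = 0 := by
    have e : (GradOp (fine n M) (n : ℂ))ᴴ *ᵥ unc W = (n : ℂ) • VariationalVectorWeitzenbock.divV (fine n M) (flatR n M) W := by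
      rw [VariationalVectorGaugeSliceB5.GradOpH_unc]; rfl
    rw [e, Matrix.mulVec_smul, hdiv, smul_zero]
  exact HkOp_minimum_unique n M B (unc W) hA hR hcurl'

/-! ## §3 The road's effective operator read on `H_k` -/

/-- **THE ROAD's FLAT EFFECTIVE OPERATOR IS THE CURVATURE-ENERGY FORM OF `H_k`**: for `1 ≤ d` and any auxiliary `a > 0`,
`Re⟨unc φ, effV n M 1 (GmFlat n M) (QmL n M 1) a · unc φ⟩ = n^{−d}·Re⟨H_k(unc φ), (Δ−∂∂ᴴ)H_k(unc φ)⟩`. [folklore] -/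
theorem effV_flat_form_eq_HkOp (hd : 1 ≤ d) {a : ℝ} (ha : 0 < a) (φ : Tor M → Fin d → ℂ) :
    qform (effV n M (flatR n M) (GmFlat n M) (QmL n M (fun _ _ _ _ => (1 : ℂ →L[ℂ] ℂ))) a) (unc φ)
      = ((n : ℝ) ^ d)⁻¹ * (star (HkOp n M *ᵥ unc φ) ⬝ᵥ (DstarD n M *ᵥ (HkOp n M *ᵥ unc φ))).re := by
  have hQ : Function.Surjective (QmL n M (fun _ _ _ _ => (1 : ℂ →L[ℂ] ℂ))).mulVec :=
    QmL_mulVec_surjective _ _ (QvL_flat_surjective n M hd)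
  have hP : ∀ W, VariationalVectorForm.qWV n M W ≤ ((d + 1 : ℝ) * B5Prop11Plancherel.Cst d 1)
      * (ScV n M (flatR n M) (projG (fine n M) (flatR n M) (kerAvgFlat n M)) W
        + nsqV M (VariationalVectorEffective.avg n M (QmL n M (fun _ _ _ _ => (1 : ℂ →L[ℂ] ℂ))) W)) := fun W => by
    rw [avg_QmL]; exact hPc_flat n M W
  have h := blockSpin_ScV_eq n M (flatR n M) (GmFlat_posSemidef n M) (projG_flat_eq_qform n M) hQ hP ha φ
  rw [avg_QmL_eq, blockSpin_flat_eq_HkOp] at h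
  unfold qform
  exact h.symm

/-! ## §4 [B5]'s normalised `H_k` energies converge along the tower -/

/-- **THE `U = 1` VECTOR END ON [B5]'s `H_k`**: for `1 ≤ d`, `2 ≤ L` there is a Hermitian-form limit `X∞` on unit-lattice 1-forms with
`n_k^{−d}·Re⟨H_{n_k}B, (Δ−∂∂ᴴ)H_{n_k}B⟩ → Re⟨B, X∞ B⟩` for every datum `B`, `n_k = L^k` — the minimal curvature energies of Bałaban's block-spin minimisers ([B5] (1.63), p.29),
per unit volume, converge as the lattice is refined (rate `L^{−2k}` in operator norm: `VariationalVectorEndFlatMin.effV_flat_limit`).  Free field; a statement about the cell's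
kernel reproduction of [B5]'s objects. [folklore] -/
theorem HkOp_energy_tendsto (hd : 1 ≤ d) (L : ℕ) [NeZero L] (hL : 2 ≤ L) :
    ∃ Xlim : Matrix (Tor M × Fin d) (Tor M × Fin d) ℂ, ∀ B : Tor M × Fin d → ℂ,
      Tendsto (fun k => (((L ^ k : ℕ) : ℝ) ^ d)⁻¹ * (star (HkOp (L ^ k) M *ᵥ B) ⬝ᵥ (DstarD (L ^ k) M *ᵥ (HkOp (L ^ k) M *ᵥ B))).re)
        atTop (𝓝 (qform Xlim B)) := by
  obtain ⟨Xlim, hT, -⟩ := effV_flat_limit L M hd hL one_pos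
  refine ⟨Xlim, fun B => ?_⟩
  have e : (fun k => (((L ^ k : ℕ) : ℝ) ^ d)⁻¹ * (star (HkOp (L ^ k) M *ᵥ B) ⬝ᵥ (DstarD (L ^ k) M *ᵥ (HkOp (L ^ k) M *ᵥ B))).re)
      = fun k => qform (effV (L ^ k) M (flatR (L ^ k) M) (Gmk L M k) (QmL (L ^ k) M (fun _ _ _ _ => (1 : ℂ →L[ℂ] ℂ))) 1) B := by
    funext k
    have h := effV_flat_form_eq_HkOp (L ^ k) M hd one_pos (cur B)
    rw [unc_cur] at h
    exact h.symm
  rw [e]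
  exact ((continuous_qform_left B).tendsto Xlim).comp hT

/-- a real quadratic form is controlled by the `ℓ²`-operator norm: `|qform X v| ≤ ‖X‖·nsq v` (leaf-07's `re_form_le_opNorm`, both signs). [folklore] -/
theorem abs_qform_le {ι : Type*} [Fintype ι] [DecidableEq ι] (X : Matrix ι ι ℂ) (v : ι → ℂ) : |qform X v| ≤ ‖X‖ * nsq v := by
  have key : ∀ Y : Matrix ι ι ℂ, qform Y v ≤ ‖Y‖ * nsq v := fun Y => by
    have h := re_form_le_opNorm Y v
    have e : qform Y v = (star (Y *ᵥ v) ⬝ᵥ v).re := by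
      unfold qform
      rw [Matrix.star_dotProduct, Complex.star_def, Complex.conj_re]
    rw [e]; exact h
  rw [abs_le]
  refine ⟨?_, key X⟩
  have h := key (-X)
  have e : qform (-X) v = -qform X v := by
    have := qform_sub 0 X v
    rw [zero_sub] at this
    rw [this]
    unfold qform
    simp
  rw [e, norm_neg] at h
  linarith

/-- **THE RATE IN [B5]'s LETTERS**: for `1 ≤ d`, `2 ≤ L`, with `X∞` as above, `|(L^k)^{−d}·Re⟨H_{L^k}B,(Δ−∂∂ᴴ)H_{L^k}B⟩ − Re⟨B, X∞B⟩| ≤ C⋆·(L⁻²)^k∕(1 − L⁻²)·nsq B` for every `B` and `k`,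
`C⋆ = 4(d+26)·L·C_R⋆·(Λ⋆+1)`, `Λ⋆ = lamV d 0 d 0`, `C_R⋆ = 8Λ⋆ + 8(BXp(d,1)²σ₀(d,1)⁻²)²(d+1)Cst(d,1)` (the constant of `effV_flat_limit`; astronomically non-sharp, journal
2026-08-20 l.18447). [folklore] -/
theorem HkOp_energy_rate (hd : 1 ≤ d) (L : ℕ) [NeZero L] (hL : 2 ≤ L) :
    ∃ Xlim : Matrix (Tor M × Fin d) (Tor M × Fin d) ℂ, ∀ (B : Tor M × Fin d → ℂ) (k : ℕ),
      |(((L ^ k : ℕ) : ℝ) ^ d)⁻¹ * (star (HkOp (L ^ k) M *ᵥ B) ⬝ᵥ (DstarD (L ^ k) M *ᵥ (HkOp (L ^ k) M *ᵥ B))).re - qform Xlim B|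
        ≤ (4 * ((d : ℝ) + 26) * L) * (8 * lamV d 0 d 0 + 8 * (BXp d 1 ^ 2 * ((sigma0 d 1) ^ 2)⁻¹) ^ 2 * ((d + 1 : ℝ) * Cst d 1))
            * (lamV d 0 d 0 + 1) * (((L : ℝ)⁻¹) ^ 2) ^ k / (1 - ((L : ℝ)⁻¹) ^ 2) * nsq B := by
  obtain ⟨Xlim, -, hR⟩ := effV_flat_limit L M hd hL one_pos
  refine ⟨Xlim, fun B k => ?_⟩
  have h := effV_flat_form_eq_HkOp (L ^ k) M hd one_pos (cur B)
  rw [unc_cur] at h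
  rw [← h, ← qform_sub]
  exact (abs_qform_le _ B).trans (mul_le_mul_of_nonneg_right (hR k) (nsq_nonneg B))

end Summit.QuantumFields.BalabanUV.T4Continuum.VariationalVectorEndFlatB5

end
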